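import Summits.BirchSwinnertonDyer.BirchSwinnertonDyer.Theorems.MordellShaFreeCutThreeAdicHsiehDescentOfValueReciprocity
import HarnessLib

set_option linter.dupNamespace false
set_option autoImplicit false

/-! # Route `MordellShaFreeCut` (rung S2b) — the `R₀`-DESCENT residual of (LB-exist) at the additive prime `3` from the PRINTED
Tate–Sen theorem + ONE named value-reciprocity clause — PART 2 of 2: the clause `ThreeAdicBDPValueReciprocity` and the censuses

Cell `bsd-cn100`, prover seat `bsd-cn100-s2b-c3` (g8). Supports, does not close, stmt-BirchSwinnertonDyer-19160 (crux B
`AnalyticRankOneOfRankOneFiniteShaThree`); serves the existence half of stmt-BirchSwinnertonDyer-19159's registered stub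
`stub_threeAdicBDPElementExistsWithValue` (line `heegner-field-bdp-triple` v6bq). PART 1
(`MordellShaFreeCutThreeAdicHsiehDescentOfValueReciprocity.lean`) PROVED
`threeAdicHsiehDescent_of_tateSenCharacter_of_sharpValueReciprocity : TateSenCharacterVanishing 3 → (VR clause, inline) →
ThreeAdicHsiehDescent` (x11b3's landed K4″/sharp engine re-run at `j = 0`, `3² ∣ N`). THIS FILE names the clause and
rewrites the S2b censuses of `MordellShaFreeCutThreeAdicHsiehDescent.lean` (p481496) with the descent REPLACED by
{Tate–Sen, the clause}:

* §1 `ThreeAdicBDPValueReciprocity` (`@[conjecture] def`, nothing asserted) — x11b3's SHARP clause (VR-B_U)|κ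
  (`Theorems.ClassRecordThreeDefs.ValueReciprocityBAtThree`, there on the `3 ∥ N` / `ClassX11b` / `Surj` / `Odd d_K` binders)
  on the binders of `ThreeAdicHsiehDescent` (`W.j = 0`, Heegner hypothesis for `N = N_W`, `3` split, `v ∋ 3`, `ι′` inducing
  `v`, `κ` anticyclotomic, EVERY imaginary quadratic `K`): some `Ω ∈ ℂˣ` and `m ≥ 1`, `3 ∤ m`, such that for every
  `τ ∈ Gal(ℚ̄₃/ℚ₃(μ_m))`, every `σ ∈ Aut(ℂ/ℚ)` over `τ` (`σ ∘ ι′ = ι′ ∘ τ`) and every everywhere-unramified Hecke character `χ`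
  of `K` of infinity type `(n, −n)`, `n > 0`, whose `3`-adic avatar factors through `κ`: `σ(V(χ)) = V(χ^σ)` with
  `V(χ) = bdpInterpolationValue 3 f v χ n Ω` (Castella's value `Γ(n)Γ(n+1)(1 − a₃3⁻¹χ(v̄))²L(f/K,χ,1)/(π^{2n+1}Ω^{4n})`; at
  `j = 0`, `a₃ = 0`). The SHAPE of the Shimura–Katz–BDP reciprocity law for the critical Rankin–Selberg values `L(f × θ_χ, ·)`
  over the CM period (BDP13 Prop. 1.12 (1), (5.1.16), Thm. 5.4, Lemma 5.3 — standing hypotheses `c·d_K` odd, `(N, d_K) = 1` —;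
  Katz 1978 (2.4.5) = Hida–Tilouine 1993 Thm. 1.1; the field of values is unramified above `3`, whence the `μ_m`).
  PRINT-DERIVABLE where those hypotheses hold (x11b3 LIT-TABLE L72 (β) / L90 (E)); stated here for EVERY datum of the node —
  a LABELLED statement for the readers, NOT asserted, NOT discharged.
* §2 `threeAdicHsiehDescent_of_tateSenCharacter_of_valueReciprocity : TateSenCharacterVanishing 3 →
  ThreeAdicBDPValueReciprocity → ThreeAdicHsiehDescent` (PART 1 by name; `δ`-unfolding of the def).
* §3 censuses: `threeAdicBDPElementExists_of_anyLevel_of_tateSen_of_valueReciprocity` ((LB-exist) ⟸ (T1) + Tate–Sen + the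
  clause, over p481496's `threeAdicBDPElementExists_of_anyLevel_of_descent`) and
  **`cruxB_of_anyLevel_of_tateSen_of_valueReciprocity`** (crux B `AnalyticRankOneOfRankOneFiniteShaThree` ⟸ (T1)
  [citation-borne, `Hsieh2014.thmA_exists_isHsiehLFunction_unrPeriod_anyLevel`] + Tate–Sen [PRINTED named fact
  `Literature.NumberTheory.PAdicHodge.TateSenCharacterVanishing 3`] + `ThreeAdicBDPValueReciprocity` [labelled] + (LB-bdp)
  ∀-frame [⟸ one frame with its value at every ι′, p479337] + (LB-wan) [research] + six refereed facts).

NET EFFECT on the S2b existence-half label (plan g16 RULING-1 (4)): «(T1) PRINT AS TYPED + ONE typed descent statement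
`ThreeAdicHsiehDescent` [OPEN]» becomes «(T1) + Tate–Sen [PRINTED, named fact, cite-only] + ONE archimedean value-reciprocity
clause `ThreeAdicBDPValueReciprocity` [print-derivable shape; labelled] + kernel translation PROVED (x11b3's engine at j = 0)».
HONEST FRAMING: CONDITIONAL reductions + one NAMED statement; nothing here proves Tate–Sen, the clause, the descent, (LB-wan),
(LB-bdp), crux A, crux B, the leaf, Sylvester's conjecture or any case of BSD. PARTITION: none — RANK axis.

References: [BertoliniDarmonPrasanna2013] Prop. 1.12 (1), (5.1.16), Thm. 5.4, Lemma 5.3; [HidaTilouine1993] Thm. 1.1;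
[Katz1978] (2.4.5); [Castella2018] Thm. 3.1; [CastellaHsieh2018] Def. 3.5, Prop. 3.6; [Hsieh2014] Thm. 1;
[BrinonConrad2009] Thm 2.2.7; [Tate1967] §3.3 Thm 2; [CastellaGrossiLeeSkinner2022] §5.2; [GrossZagier1986] I.6.3.
-/

noncomputable section

open scoped NumberField Classical
open NumberField IsDedekindDomain Field WeierstrassCurve
open Literature.NumberTheory.GaloisRepresentations Literature.NumberTheory.EllipticCurves
  Literature.NumberTheory.EllipticCurves.ModularForms
open Literature.NumberTheory.PAdicHodge (TateSenCharacterVanishing)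
open Summit.BirchSwinnertonDyer.BirchSwinnertonDyer.Theses.MordellShaFreeCut (AnalyticRankOneOfRankOneFiniteShaThree)
open Summit.BirchSwinnertonDyer.BirchSwinnertonDyer.Theorems.MordellShaFreeCutThreeAdicBDPTriple
  (ThreeAdicBDPElementExists ThreeAdicWanDivisibility ThreeAdicBDPValueAtOne)
open Summit.BirchSwinnertonDyer.BirchSwinnertonDyer.Theorems.MordellShaFreeCutThreeAdicHsiehDescent
  (ThreeAdicHsiehDescent threeAdicBDPElementExists_of_anyLevel_of_descent cruxB_of_anyLevel_of_descent)
open Summit.BirchSwinnertonDyer.BirchSwinnertonDyer.Theorems.MordellShaFreeCutThreeAdicHsiehDescentOfValueReciprocity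
  (threeAdicHsiehDescent_of_tateSenCharacter_of_sharpValueReciprocity)

namespace Summit.BirchSwinnertonDyer.BirchSwinnertonDyer.Theorems.MordellShaFreeCutThreeAdicBDPValueReciprocity

/-! ## 1. The value-reciprocity clause (named, nothing asserted) -/

/-- **Value reciprocity for Castella's interpolation values of the newform of a `j = 0` curve at a prime of `K` above the
split prime `3`, on the `κ`-range, exact on `Gal(ℚ̄₃/ℚ₃(μ_m))`** — x11b3's SHARP clause (VR-B_U)|κ
(`Theorems.ClassRecordThreeDefs.ValueReciprocityBAtThree`, there on the `3 ∥ N` / `ClassX11b` / `Surj` / `Odd d_K` binders)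
stated on the binders of `ThreeAdicHsiehDescent`: for `W/ℚ` globally minimal elliptic with `j = 0`, `f` the newform of `W` of
level `N = N_W`, `K` imaginary quadratic with the Heegner hypothesis for `N` and `3` split, `v ∋ 3`, an embedding datum
`ι′ : ℚ̄₃ ≃ ℂ` inducing `v`, `κ` anticyclotomic — some `Ω ∈ ℂˣ` and `m ≥ 1`, `3 ∤ m`, such that for every
`τ ∈ Gal(ℚ̄₃/ℚ₃(μ_m))`, every `σ ∈ Aut(ℂ/ℚ)` over `τ` (`σ ∘ ι′ = ι′ ∘ τ`) and every everywhere-unramified Hecke character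
`χ` of `K` of infinity type `(n, −n)`, `n > 0`, whose `3`-adic avatar factors through `κ`:
`σ (bdpInterpolationValue 3 f v χ n Ω) = bdpInterpolationValue 3 f v χ^σ n Ω`. The SHAPE of the Shimura–Katz–BDP reciprocity
law for the critical values `L(f/K, χ, 1) = L(f × θ_χ, ·)` over the CM period (BDP13 Prop. 1.12 (1), (5.1.16), Thm. 5.4,
Lemma 5.3 — standing hypotheses `c·d_K` odd, `(N, d_K) = 1`; Katz 1978 (2.4.5) = Hida–Tilouine 1993 Thm. 1.1; `ι′⁻¹` of the
field generated by the values is unramified above `3`, whence the `μ_m`). PRINT-DERIVABLE where those hypotheses hold;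
stated for EVERY datum of the node. A LABELLED statement; TYPED, not attempted; nothing asserted.
[cite: BertoliniDarmonPrasanna2013, Thm. 5.4 and Lemma 5.3 (shape only; nothing asserted)]
[cite: HidaTilouine1993, Thm. 1.1 (p. 200) (shape only; nothing asserted)]
[cite: Castella2018, Thm. 3.1 (arXiv:1704.06608 p. 9) (the interpolation value)] -/
@[conjecture] def ThreeAdicBDPValueReciprocity : Prop :=
  ∀ (W : WeierstrassCurve ℚ) [W.IsElliptic] [W.IsGloballyMinimal], W.j = 0 →
    ∀ (ι' : PadicAlgCl 3 ≃+* ℂ) (K : Type) [Field K] [NumberField K] (v : HeightOneSpectrum (𝓞 K))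
      (κ : ZpExtension K 3) {N : ℕ} [NeZero N] (f : CuspForm (CongruenceSubgroup.Gamma0 N) 2),
      IsNewformOf W f → W.conductorNorm ℤ = N → IsImaginaryQuadratic K → SatisfiesHeegnerHypothesis N K →
      ((Ideal.span {(3 : ℤ)}).primesOver (𝓞 K)).ncard = 2 → ((3 : ℕ) : 𝓞 K) ∈ v.asIdeal →
      (∀ (w : InfinitePlace K) (k : 𝓞 K), k ∈ v.asIdeal ↔ ‖ι'.symm (w.embedding (k : K))‖ < 1) →
      κ.IsAnticyclotomic →
      ∃ Ω : ℂ, Ω ≠ 0 ∧ ∃ m : ℕ, 0 < m ∧ ¬ 3 ∣ m ∧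
        (∀ (τ : PadicAlgCl 3 ≃ₐ[ℚ_[3]] PadicAlgCl 3) (σ : ℂ ≃ₐ[ℚ] ℂ),
          (∀ ζ : PadicAlgCl 3, ζ ^ m = 1 → τ ζ = ζ) →
          (∀ z : PadicAlgCl 3, σ (ι' z) = ι' (τ z)) →
          ∀ (χ : HeckeCharacter K) (n : ℕ), 0 < n →
            (∀ w : HeightOneSpectrum (𝓞 K), χ.IsUnramifiedAt w) →
            ∀ hχ : χ.HasInfinityType (fun _ ↦ (n : ℤ)) (fun _ ↦ -(n : ℤ)),
              ∀ r : FramedGaloisRep K (PadicAlgCl 3) 1, IsPAdicAvatarOf ι' χ r → FactorsThroughZp κ r →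
                σ (bdpInterpolationValue 3 f v χ n Ω) =
                  bdpInterpolationValue 3 f v (hχ.autConj σ) n Ω)

/-! ## 2. The descent from Tate–Sen and the named clause (PART 1 by name) -/

/-- **`ThreeAdicHsiehDescent` ⟸ {the PRINTED Tate–Sen theorem `TateSenCharacterVanishing 3` (named fact, NOT asserted), the
clause `ThreeAdicBDPValueReciprocity` (labelled, NOT discharged)}** — PART 1's
`threeAdicHsiehDescent_of_tateSenCharacter_of_sharpValueReciprocity`, whose inline hypothesis IS the clause by `δ`-unfolding.
CONDITIONAL; nothing discharged. [cite: BrinonConrad2009, Thm. 2.2.7] [cite: Hsieh2014, Thm. 1 (arXiv:1112.1580 pp. 3–4)] -/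
theorem threeAdicHsiehDescent_of_tateSenCharacter_of_valueReciprocity (hTS : TateSenCharacterVanishing 3)
    (hVR : ThreeAdicBDPValueReciprocity) : ThreeAdicHsiehDescent :=
  threeAdicHsiehDescent_of_tateSenCharacter_of_sharpValueReciprocity hTS hVR

/-! ## 3. Censuses: (LB-exist) and crux B with the descent replaced by {Tate–Sen, value reciprocity} -/

/-- **(LB-exist) `ThreeAdicBDPElementExists` ⟸ Hsieh 2014 Thm A at any level (`hT1`, citation-borne) + the PRINTED Tate–Sen
theorem (`hTS`, named fact) + the value-reciprocity clause (`hVR`, labelled)** — p481496's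
`threeAdicBDPElementExists_of_anyLevel_of_descent` over §2. CONDITIONAL; credits nothing beyond the reduction.
[cite: Hsieh2014, Thm. A p. 712 = Thm. 1 (arXiv:1112.1580 pp. 3–4)] [cite: BrinonConrad2009, Thm. 2.2.7] -/
theorem threeAdicBDPElementExists_of_anyLevel_of_tateSen_of_valueReciprocity
    (hT1 : Hsieh2014.thmA_exists_isHsiehLFunction_unrPeriod_anyLevel) (hTS : TateSenCharacterVanishing 3)
    (hVR : ThreeAdicBDPValueReciprocity) : ThreeAdicBDPElementExists :=
  threeAdicBDPElementExists_of_anyLevel_of_descent hT1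
    (threeAdicHsiehDescent_of_tateSenCharacter_of_valueReciprocity hTS hVR)

/-- **KERNEL CENSUS OF CRUX B with the descent REDUCED: `AnalyticRankOneOfRankOneFiniteShaThree` ⟸ Hsieh 2014 Thm A at any
level (`hT1`, citation-borne) + Tate–Sen (`hTS`, PRINTED named fact) + `ThreeAdicBDPValueReciprocity` (`hVR`, labelled) +
(LB-bdp) ∀-frame (`hV`; ⟸ one frame with its value at every `ι'`, p479337) + (LB-wan) (`hWan`, research) + six refereed
facts** (`3`-parity, modularity, Hoffstein–Luo, Kato, existence of Heegner points, Gross–Zagier + Kolyvagin) — via p481496's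
`cruxB_of_anyLevel_of_descent`. CONDITIONAL; credits nothing; BSD and Sylvester's conjecture untouched.
[cite: CastellaGrossiLeeSkinner2022, §5.2 (proof of Thm. 5.2.1)] [cite: GrossZagier1986, Thm. I.6.3 with V.§2]
[cite: BrinonConrad2009, Thm. 2.2.7] -/
theorem cruxB_of_anyLevel_of_tateSen_of_valueReciprocity
    (hpar : ∀ (W : WeierstrassCurve ℚ) [W.IsElliptic] (p : ℕ) [Fact p.Prime], p_parity W p)
    (hmod : ModularForms.exists_isNewformOf) (hHL : HoffsteinLuo1997_exists_twist_L_one_ne_zero)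
    (hKato : ∀ (W : WeierstrassCurve ℚ) [W.IsElliptic] (p : ℕ) [Fact p.Prime],
      kato_finite_of_L_one_ne_zero W p)
    (hHP : ∀ (W : WeierstrassCurve ℚ) (K : Type) [Field K] [NumberField K],
      exists_isHeegnerPoint W K)
    (hGZ : ∀ (W : WeierstrassCurve ℚ) (N : ℕ) [NeZero N] (K : Type) [Field K] [NumberField K],
      analyticRankEK_eq_one_iff_heegner_nonTorsion W N K)
    (hT1 : Hsieh2014.thmA_exists_isHsiehLFunction_unrPeriod_anyLevel) (hTS : TateSenCharacterVanishing 3)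
    (hVR : ThreeAdicBDPValueReciprocity) (hV : ThreeAdicBDPValueAtOne) (hWan : ThreeAdicWanDivisibility) :
    AnalyticRankOneOfRankOneFiniteShaThree :=
  cruxB_of_anyLevel_of_descent hpar hmod hHL hKato hHP hGZ hT1
    (threeAdicHsiehDescent_of_tateSenCharacter_of_valueReciprocity hTS hVR) hV hWan

end Summit.BirchSwinnertonDyer.BirchSwinnertonDyer.Theorems.MordellShaFreeCutThreeAdicBDPValueReciprocity

end
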